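import Summits.KontsevichZagierPeriods.Zeta5Search.Certificates.RecordRayGrowthUpper
import Summits.KontsevichZagierPeriods.Zeta5Search.Certificates.LogEnclosuresRecord2
import HarnessLib

/-!
# ζ(5) search — certificates: the growth of `Q(a·n)` on the record ray — III: the sharp lower bound (certifier 2)

HONEST FRAMING: systematic search; no irrationality claim unless certified.

OUR work (Summit side). `Certificates/RecordRayGrowth.lean` bounds `log|Q(a·n)|` from below by the entropy of the
INTEGER lattice term `(24n, 23n)` (`E ≥ 85.0519`), `0.036` nats short of the supremum `85.0876888342…` attained at
`(x*, y*)·n = (24.1294931…, 23.2542144…)·n`. Here the lattice term is taken at the FLOOR point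
`(⌊48259n/2000⌋, ⌊116271n/5000⌋)` (`κ = (24.1295, 23.2542)`), whose entropy rate `growthEntSharp = g(κ) = 85.0876888341…`
is within `1.1·10⁻¹⁰` of the supremum:

* `xlogx_sub_le` / `ent_ge_of_near` — `x log x` is `(1 + log M)`-Lipschitz on `[1, M]` (tangent inequalities from
  `log z ≥ 1 − 1/z`), hence the entropy `ent(m,k) = m log m − k log k − (m−k) log(m−k)` moves by at most `12(1 + log M)`
  when `(m,k)` moves by `≤ 2` in each coordinate (the floors);
* `abs_recordQ_ge_sharp` — for every `n ≥ 1`: `n·g(κ) − (175/2)·log(31n) − 98 ≤ log|Q(a·n)|`;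
* `growthEntSharp_ge` — `g(κ) ≥ 85.08768883` (certified logarithms, `LogEnclosuresRecord2`);
* `eventually_exp_le_abs_recordQ_sharp` and `rate_mem_of_tendsto_sharp` — ANY limit of `log|Q(a·n)|/n` lies in the
  closed printed bracket `[85.08768883, 85.08768884]` of the FACT `BrownZudilin2022.record_rates`: BOTH ends of the
  Q-half of that fact are now theorems about the actual sequence (the fact itself — existence of the limit — is not
  proved here; `liminf ≥ 85.08768883` and `limsup ≤ 85.08768884` are).
-/

noncomputable section

open Finset Real Filter Topology

namespace Summit.KontsevichZagierPeriods.Zeta5Search.RecordRay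

open Summit.KontsevichZagierPeriods.Zeta5Search.BinomialSum
open Summit.KontsevichZagierPeriods.Zeta5Search.LogEnclosures
open Literature.NumberTheory.Irrationality.BrownZudilin2022 (zchoose Qcoeff)
open Literature.Analysis.SpecialFunctions (log_choose_ge_entropy entropy_eq_mul_scaled)

/-! ### `x log x` is Lipschitz on `[1, M]` -/

/-- Tangent inequality of the convex function `x log x`: `x log x − y log y ≤ (1 + log x)(x − y)` (`x, y > 0`). -/
theorem xlogx_sub_le_tangent {x y : ℝ} (hx : 0 < x) (hy : 0 < y) :
    x * Real.log x - y * Real.log y ≤ (1 + Real.log x) * (x - y) := by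
  -- `y log(y/x) ≥ y − x`
  have h := Real.one_sub_inv_le_log_of_pos (div_pos hy hx)
  rw [inv_div, Real.log_div hy.ne' hx.ne'] at h
  have h2 : y * (1 - x / y) ≤ y * (Real.log y - Real.log x) := mul_le_mul_of_nonneg_left h hy.le
  have h3 : y * (1 - x / y) = y - x := by field_simp
  nlinarith

/-- `|x log x − y log y| ≤ (1 + log M)·|x − y|` for `x, y ∈ [1, M]`. -/
theorem abs_xlogx_sub_le {x y M : ℝ} (hx : 1 ≤ x) (hy : 1 ≤ y) (hxM : x ≤ M) (hyM : y ≤ M) :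
    |x * Real.log x - y * Real.log y| ≤ (1 + Real.log M) * |x - y| := by
  have hx0 : 0 < x := by linarith
  have hy0 : 0 < y := by linarith
  have h1 := xlogx_sub_le_tangent hx0 hy0
  have h2 := xlogx_sub_le_tangent hy0 hx0
  have lx : 0 ≤ Real.log x := Real.log_nonneg hx
  have ly : 0 ≤ Real.log y := Real.log_nonneg hy
  have lxM : Real.log x ≤ Real.log M := Real.log_le_log hx0 hxM
  have lyM : Real.log y ≤ Real.log M := Real.log_le_log hy0 hyM
  rw [abs_le]
  rcases le_total x y with hxy | hxy
  · rw [abs_of_nonpos (by linarith : x - y ≤ 0)]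
    constructor <;> nlinarith
  · rw [abs_of_nonneg (by linarith : 0 ≤ x - y)]
    constructor <;> nlinarith

/-- The entropy form `ent(m,k) = m log m − k log k − (m−k) log(m−k)`. -/
def ent (m k : ℝ) : ℝ := m * Real.log m - k * Real.log k - (m - k) * Real.log (m - k)

/-- **Floor stability of the entropy**: if `k, k' ≥ 1`, `m − k, m' − k' ≥ 1`, `m, m' ≤ M` and `|m − m'| ≤ 2`, `|k − k'| ≤ 2`,
then `ent(m,k) ≥ ent(m',k') − 12·(1 + log M)`. -/
theorem ent_ge_of_near {m k m' k' M : ℝ} (hk : 1 ≤ k) (hk' : 1 ≤ k') (hmk : 1 ≤ m - k) (hmk' : 1 ≤ m' - k')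
    (hM : m ≤ M) (hM' : m' ≤ M) (hdm : |m - m'| ≤ 2) (hdk : |k - k'| ≤ 2) :
    ent m' k' - 12 * (1 + Real.log M) ≤ ent m k := by
  have hm : 1 ≤ m := by linarith
  have hm' : 1 ≤ m' := by linarith
  have hL : 0 ≤ 1 + Real.log M := by linarith [Real.log_nonneg (hm.trans hM)]
  have a1 := abs_xlogx_sub_le hm hm' hM hM'
  have a2 := abs_xlogx_sub_le hk hk' (by linarith : k ≤ M) (by linarith : k' ≤ M)
  have a3 := abs_xlogx_sub_le hmk hmk' (by linarith : m - k ≤ M) (by linarith : m' - k' ≤ M)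
  have d3 : |m - k - (m' - k')| ≤ 4 := by
    rw [show m - k - (m' - k') = (m - m') - (k - k') by ring]
    exact (abs_sub _ _).trans (by linarith)
  rw [abs_le] at a1 a2 a3
  have b1 : (1 + Real.log M) * |m - m'| ≤ (1 + Real.log M) * 2 := mul_le_mul_of_nonneg_left hdm hL
  have b2 : (1 + Real.log M) * |k - k'| ≤ (1 + Real.log M) * 2 := mul_le_mul_of_nonneg_left hdk hL
  have b3 : (1 + Real.log M) * |m - k - (m' - k')| ≤ (1 + Real.log M) * 4 := mul_le_mul_of_nonneg_left d3 hL
  unfold ent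
  linarith [a1.1, a1.2, a2.1, a2.2, a3.1, a3.2]

/-- Stirling + floor stability: for naturals `k ≤ m` with `1 ≤ k`, `1 ≤ m − k`, `m ≤ M`, and a real point `(m',k')` with
`1 ≤ k'`, `1 ≤ m' − k'`, `m' ≤ M`, `|m − m'| ≤ 2`, `|k − k'| ≤ 2`:  `ent(m',k') − 12(1 + log M) − log M/2 − 2 ≤ log C(m,k)`. -/
theorem log_choose_ge_near {m k : ℕ} {m' k' M : ℝ} (hkm : k ≤ m) (hk : 1 ≤ k) (hmk : k + 1 ≤ m) (hM : (m : ℝ) ≤ M)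
    (hk' : 1 ≤ k') (hmk' : 1 ≤ m' - k') (hM' : m' ≤ M) (hdm : |(m : ℝ) - m'| ≤ 2) (hdk : |(k : ℝ) - k'| ≤ 2) :
    ent m' k' - 12 * (1 + Real.log M) - Real.log M / 2 - 2 ≤ Real.log (m.choose k) := by
  have h := log_choose_ge_entropy (m := m) (k := k) (by omega) hkm
  have hkR : (1 : ℝ) ≤ k := by exact_mod_cast hk
  have hmkR : (1 : ℝ) ≤ (m : ℝ) - k := by
    have : ((k + 1 : ℕ) : ℝ) ≤ m := by exact_mod_cast hmk
    push_cast at this; linarith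
  have e := ent_ge_of_near hkR hk' hmkR hmk' hM hM' hdm hdk
  have hlogM : Real.log m ≤ Real.log M := Real.log_le_log (by linarith) hM
  unfold ent at e ⊢
  linarith

/-! ### The floor lattice point `κ·n`, `κ = (24.1295, 23.2542)` -/

/-- `k₁ = ⌊24.1295·n⌋`. -/
def kf₁ (n : ℕ) : ℕ := 48259 * n / 2000
/-- `k₂ = ⌊23.2542·n⌋`. -/
def kf₂ (n : ℕ) : ℕ := 116271 * n / 5000

/-- `24n ≤ ⌊24.1295·n⌋ ≤ 25n`. -/
theorem kf₁_bounds (n : ℕ) : 24 * n ≤ kf₁ n ∧ kf₁ n ≤ 25 * n := by unfold kf₁; omega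

/-- `23n ≤ ⌊23.2542·n⌋ ≤ 24n`. -/
theorem kf₂_bounds (n : ℕ) : 23 * n ≤ kf₂ n ∧ kf₂ n ≤ 24 * n := by unfold kf₂; omega

/-- `2000·k₁ ≤ 48259n < 2000(k₁+1)`. -/
theorem kf₁_floor (n : ℕ) : 2000 * kf₁ n ≤ 48259 * n ∧ 48259 * n < 2000 * (kf₁ n + 1) := by unfold kf₁; omega

/-- `5000·k₂ ≤ 116271n < 5000(k₂+1)`. -/
theorem kf₂_floor (n : ℕ) : 5000 * kf₂ n ≤ 116271 * n ∧ 116271 * n < 5000 * (kf₂ n + 1) := by unfold kf₂; omega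

/-- The floor term of (17) is the product of its seven (genuine) binomials, `n ≥ 1`. -/
theorem floorTerm_eq (n : ℕ) :
    qTerm (pRec n) (qRec n) (kf₁ n) (kf₂ n) =
      ((kf₁ n).choose (15 * n) : ℤ) * ((kf₂ n).choose (12 * n) : ℤ) * ((kf₁ n + kf₂ n - 17 * n).choose (12 * n) : ℤ)
        * ((15 * n).choose (kf₁ n - 14 * n) : ℤ) * ((12 * n).choose (kf₁ n - 16 * n) : ℤ)
        * ((8 * n).choose (kf₂ n - 18 * n) : ℤ) * ((16 * n).choose (kf₂ n - 13 * n) : ℤ) := by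
  obtain ⟨h1l, h1u⟩ := kf₁_bounds n
  obtain ⟨h2l, h2u⟩ := kf₂_bounds n
  unfold qTerm
  simp only [pRec_0, pRec_1, pRec_2, pRec_3, pRec_4, pRec_5, pRec_6, qRec_0, qRec_1, qRec_2, qRec_3, qRec_4]
  rw [zchoose_cast_eq (n := kf₁ n) (k := 15 * n) rfl (by push_cast; ring) (by omega),
    zchoose_cast_eq (n := kf₂ n) (k := 12 * n) rfl (by push_cast; ring) (by omega),
    zchoose_cast_eq (n := kf₁ n + kf₂ n - 17 * n) (k := 12 * n)
      (by rw [Nat.cast_sub (by omega)]; push_cast; ring) (by push_cast; ring) (by omega),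
    zchoose_cast_eq (n := 15 * n) (k := kf₁ n - 14 * n) (by push_cast; ring)
      (by rw [Nat.cast_sub (by omega)]; push_cast; ring) (by omega),
    zchoose_cast_eq (n := 12 * n) (k := kf₁ n - 16 * n) (by push_cast; ring)
      (by rw [Nat.cast_sub (by omega)]; push_cast; ring) (by omega),
    zchoose_cast_eq (n := 8 * n) (k := kf₂ n - 18 * n) (by push_cast; ring)
      (by rw [Nat.cast_sub (by omega)]; push_cast; ring) (by omega),
    zchoose_cast_eq (n := 16 * n) (k := kf₂ n - 13 * n) (by push_cast; ring)
      (by rw [Nat.cast_sub (by omega)]; push_cast; ring) (by omega)]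

/-- The entropy rate at `κ = (48259/2000, 116271/5000)`: `g(κ) = 85.0876888341…` (sup `85.0876888342…`). -/
def growthEntSharp : ℝ :=
  ent (48259 / 2000) 15 + ent (116271 / 5000) 12 + ent (48259 / 2000 + 116271 / 5000 - 17) 12
  + ent 15 (48259 / 2000 - 14) + ent 12 (48259 / 2000 - 16) + ent 8 (116271 / 5000 - 18) + ent 16 (116271 / 5000 - 13)

/-- Real bounds for the first floor: `κ₁n − 1 ≤ k₁ ≤ κ₁n`. -/
theorem kf₁_real (n : ℕ) : (48259 / 2000 : ℝ) * n - 1 ≤ (kf₁ n : ℝ) ∧ (kf₁ n : ℝ) ≤ 48259 / 2000 * n := by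
  obtain ⟨a, b⟩ := kf₁_floor n
  have a' : (2000 : ℝ) * kf₁ n ≤ 48259 * n := by exact_mod_cast a
  have b' : (48259 : ℝ) * n < 2000 * ((kf₁ n : ℝ) + 1) := by exact_mod_cast b
  constructor <;> linarith

/-- Real bounds for the second floor: `κ₂n − 1 ≤ k₂ ≤ κ₂n`. -/
theorem kf₂_real (n : ℕ) : (116271 / 5000 : ℝ) * n - 1 ≤ (kf₂ n : ℝ) ∧ (kf₂ n : ℝ) ≤ 116271 / 5000 * n := by
  obtain ⟨a, b⟩ := kf₂_floor n
  have a' : (5000 : ℝ) * kf₂ n ≤ 116271 * n := by exact_mod_cast a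
  have b' : (116271 : ℝ) * n < 5000 * ((kf₂ n : ℝ) + 1) := by exact_mod_cast b
  constructor <;> linarith

/-- The seven per-factor lower bounds at the floor point, summed (`M = 31n`). -/
def sharpStirling (n : ℕ) : ℝ :=
  (ent (48259 / 2000 * n) (15 * n) - 12 * (1 + Real.log (31 * n)) - Real.log (31 * n) / 2 - 2)
  + (ent (116271 / 5000 * n) (12 * n) - 12 * (1 + Real.log (31 * n)) - Real.log (31 * n) / 2 - 2)
  + (ent ((48259 / 2000 + 116271 / 5000 - 17) * n) (12 * n) - 12 * (1 + Real.log (31 * n)) - Real.log (31 * n) / 2 - 2)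
  + (ent (15 * n) ((48259 / 2000 - 14) * n) - 12 * (1 + Real.log (31 * n)) - Real.log (31 * n) / 2 - 2)
  + (ent (12 * n) ((48259 / 2000 - 16) * n) - 12 * (1 + Real.log (31 * n)) - Real.log (31 * n) / 2 - 2)
  + (ent (8 * n) ((116271 / 5000 - 18) * n) - 12 * (1 + Real.log (31 * n)) - Real.log (31 * n) / 2 - 2)
  + (ent (16 * n) ((116271 / 5000 - 13) * n) - 12 * (1 + Real.log (31 * n)) - Real.log (31 * n) / 2 - 2)

/-- `sharpStirling n = n·g(κ) − (175/2)·log(31n) − 98` (scaling of the entropies). -/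
theorem sharpStirling_eq {n : ℕ} (hn : 1 ≤ n) :
    sharpStirling n = (n : ℝ) * growthEntSharp - 175 / 2 * Real.log (31 * n) - 98 := by
  have hnpos : (0 : ℝ) < n := by exact_mod_cast hn
  have hne : (n : ℝ) ≠ 0 := hnpos.ne'
  have e1 := entropy_eq_mul_scaled hnpos (48259 / 2000 * n) (15 * n)
  have e2 := entropy_eq_mul_scaled hnpos (116271 / 5000 * n) (12 * n)
  have e3 := entropy_eq_mul_scaled hnpos ((48259 / 2000 + 116271 / 5000 - 17) * n) (12 * n)
  have e4 := entropy_eq_mul_scaled hnpos (15 * n) ((48259 / 2000 - 14) * n)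
  have e5 := entropy_eq_mul_scaled hnpos (12 * n) ((48259 / 2000 - 16) * n)
  have e6 := entropy_eq_mul_scaled hnpos (8 * n) ((116271 / 5000 - 18) * n)
  have e7 := entropy_eq_mul_scaled hnpos (16 * n) ((116271 / 5000 - 13) * n)
  simp only [mul_div_assoc, div_self hne, mul_one] at e1 e2 e3 e4 e5 e6 e7
  unfold sharpStirling growthEntSharp ent
  rw [e1, e2, e3, e4, e5, e6, e7]
  ring

set_option maxHeartbeats 400000 in
/-- Stirling + floor stability for the seven factors: `exp(sharpStirling n) ≤` the floor term (`n ≥ 1`). -/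
theorem exp_le_floorTerm {n : ℕ} (hn : 1 ≤ n) :
    Real.exp (sharpStirling n) ≤ (qTerm (pRec n) (qRec n) (kf₁ n) (kf₂ n) : ℝ) := by
  obtain ⟨h1l, h1u⟩ := kf₁_bounds n
  obtain ⟨h2l, h2u⟩ := kf₂_bounds n
  obtain ⟨f1l, f1u⟩ := kf₁_real n
  obtain ⟨f2l, f2u⟩ := kf₂_real n
  have hn' : (1 : ℝ) ≤ n := by exact_mod_cast hn
  rw [floorTerm_eq n]; push_cast
  have c12 : ((kf₁ n + kf₂ n - 17 * n : ℕ) : ℝ) = (kf₁ n : ℝ) + kf₂ n - 17 * n := by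
    rw [Nat.cast_sub (by omega)]; push_cast; ring
  have c4 : ((kf₁ n - 14 * n : ℕ) : ℝ) = (kf₁ n : ℝ) - 14 * n := by rw [Nat.cast_sub (by omega)]; push_cast; ring
  have c5 : ((kf₁ n - 16 * n : ℕ) : ℝ) = (kf₁ n : ℝ) - 16 * n := by rw [Nat.cast_sub (by omega)]; push_cast; ring
  have c6 : ((kf₂ n - 18 * n : ℕ) : ℝ) = (kf₂ n : ℝ) - 18 * n := by rw [Nat.cast_sub (by omega)]; push_cast; ring
  have c7 : ((kf₂ n - 13 * n : ℕ) : ℝ) = (kf₂ n : ℝ) - 13 * n := by rw [Nat.cast_sub (by omega)]; push_cast; ring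
  have s1 := log_choose_ge_near (m := kf₁ n) (k := 15 * n) (m' := 48259 / 2000 * n) (k' := 15 * n) (M := 31 * n)
    (by omega) (by omega) (by omega) (by linarith) (by linarith) (by linarith) (by linarith)
    (by rw [abs_le]; constructor <;> linarith) (by push_cast; rw [sub_self, abs_zero]; norm_num)
  have s2 := log_choose_ge_near (m := kf₂ n) (k := 12 * n) (m' := 116271 / 5000 * n) (k' := 12 * n) (M := 31 * n)
    (by omega) (by omega) (by omega) (by linarith) (by linarith) (by linarith) (by linarith)
    (by rw [abs_le]; constructor <;> linarith) (by push_cast; rw [sub_self, abs_zero]; norm_num)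
  have s3 := log_choose_ge_near (m := kf₁ n + kf₂ n - 17 * n) (k := 12 * n)
    (m' := (48259 / 2000 + 116271 / 5000 - 17) * n) (k' := 12 * n) (M := 31 * n)
    (by omega) (by omega) (by omega) (by rw [c12]; linarith) (by linarith) (by linarith) (by linarith)
    (by rw [c12, abs_le]; constructor <;> linarith) (by push_cast; rw [sub_self, abs_zero]; norm_num)
  have s4 := log_choose_ge_near (m := 15 * n) (k := kf₁ n - 14 * n) (m' := 15 * n) (k' := (48259 / 2000 - 14) * n)
    (M := 31 * n) (by omega) (by omega) (by omega) (by push_cast; linarith) (by linarith) (by linarith) (by linarith)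
    (by push_cast; rw [sub_self, abs_zero]; norm_num) (by rw [c4, abs_le]; constructor <;> linarith)
  have s5 := log_choose_ge_near (m := 12 * n) (k := kf₁ n - 16 * n) (m' := 12 * n) (k' := (48259 / 2000 - 16) * n)
    (M := 31 * n) (by omega) (by omega) (by omega) (by push_cast; linarith) (by linarith) (by linarith) (by linarith)
    (by push_cast; rw [sub_self, abs_zero]; norm_num) (by rw [c5, abs_le]; constructor <;> linarith)
  have s6 := log_choose_ge_near (m := 8 * n) (k := kf₂ n - 18 * n) (m' := 8 * n) (k' := (116271 / 5000 - 18) * n)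
    (M := 31 * n) (by omega) (by omega) (by omega) (by push_cast; linarith) (by linarith) (by linarith) (by linarith)
    (by push_cast; rw [sub_self, abs_zero]; norm_num) (by rw [c6, abs_le]; constructor <;> linarith)
  have s7 := log_choose_ge_near (m := 16 * n) (k := kf₂ n - 13 * n) (m' := 16 * n) (k' := (116271 / 5000 - 13) * n)
    (M := 31 * n) (by omega) (by omega) (by omega) (by push_cast; linarith) (by linarith) (by linarith) (by linarith)
    (by push_cast; rw [sub_self, abs_zero]; norm_num) (by rw [c7, abs_le]; constructor <;> linarith)
  have p1 : (0 : ℝ) < ((kf₁ n).choose (15 * n) : ℝ) := by exact_mod_cast Nat.choose_pos (by omega)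
  have p2 : (0 : ℝ) < ((kf₂ n).choose (12 * n) : ℝ) := by exact_mod_cast Nat.choose_pos (by omega)
  have p3 : (0 : ℝ) < ((kf₁ n + kf₂ n - 17 * n).choose (12 * n) : ℝ) := by exact_mod_cast Nat.choose_pos (by omega)
  have p4 : (0 : ℝ) < ((15 * n).choose (kf₁ n - 14 * n) : ℝ) := by exact_mod_cast Nat.choose_pos (by omega)
  have p5 : (0 : ℝ) < ((12 * n).choose (kf₁ n - 16 * n) : ℝ) := by exact_mod_cast Nat.choose_pos (by omega)
  have p6 : (0 : ℝ) < ((8 * n).choose (kf₂ n - 18 * n) : ℝ) := by exact_mod_cast Nat.choose_pos (by omega)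
  have p7 : (0 : ℝ) < ((16 * n).choose (kf₂ n - 13 * n) : ℝ) := by exact_mod_cast Nat.choose_pos (by omega)
  have hprod := prod7_le (Real.exp_nonneg _) (Real.exp_nonneg _) (Real.exp_nonneg _) (Real.exp_nonneg _)
    (Real.exp_nonneg _) (Real.exp_nonneg _) (Real.exp_nonneg _)
    ((Real.le_log_iff_exp_le p1).1 s1) ((Real.le_log_iff_exp_le p2).1 s2) ((Real.le_log_iff_exp_le p3).1 s3)
    ((Real.le_log_iff_exp_le p4).1 s4) ((Real.le_log_iff_exp_le p5).1 s5) ((Real.le_log_iff_exp_le p6).1 s6)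
    ((Real.le_log_iff_exp_le p7).1 s7)
  refine le_trans (le_of_eq ?_) hprod
  simp only [← Real.exp_add]
  unfold sharpStirling
  ring_nf

/-- **Sharp lower bound for every `n ≥ 1`**: `n·g(κ) − (175/2)·log(31n) − 98 ≤ log|Q(a·n)|`. -/
theorem abs_recordQ_ge_sharp {n : ℕ} (hn : 1 ≤ n) :
    (n : ℝ) * growthEntSharp - 175 / 2 * Real.log (31 * n) - 98 ≤ Real.log |(recordQ n : ℝ)| := by
  obtain ⟨h1l, h1u⟩ := kf₁_bounds n
  obtain ⟨h2l, h2u⟩ := kf₂_bounds n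
  have hk₁ : ((kf₁ n : ℕ) : ℤ) ∈ Icc (pRec n 1) (pRec n 1 + qRec n 0) := by
    rw [mem_Icc, pRec_1, qRec_0]; constructor <;> omega
  have hk₂ : ((kf₂ n : ℕ) : ℤ) ∈ Icc (pRec n 4) (pRec n 4 + qRec n 3) := by
    rw [mem_Icc, pRec_4, qRec_3]; constructor <;> omega
  have hle := qTerm_le_abs_Qcoeff (pRec n) (qRec n) hk₁ hk₂
  rw [← recordQ_eq_Qcoeff] at hle
  have h := (Real.le_log_iff_exp_le (abs_recordQ_pos n)).2 ((exp_le_floorTerm hn).trans hle)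
  rw [sharpStirling_eq hn] at h
  exact h

/-- **`g(κ) ≥ 85.08768883`** (certified logarithms; `g(κ) = 85.0876888341…`). -/
theorem growthEntSharp_ge : (8508768883 / 10 ^ 8 : ℝ) ≤ growthEntSharp := by
  unfold growthEntSharp ent
  norm_num only
  have d0 : Real.log (48259 / 2000 : ℝ) = Real.log 48259 - Real.log 2000 := Real.log_div (by norm_num) (by norm_num)
  have d1 : Real.log (18259 / 2000 : ℝ) = Real.log 18259 - Real.log 2000 := Real.log_div (by norm_num) (by norm_num)
  have d2 : Real.log (116271 / 5000 : ℝ) = Real.log 116271 - Real.log 5000 := Real.log_div (by norm_num) (by norm_num)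
  have d3 : Real.log (56271 / 5000 : ℝ) = Real.log 56271 - Real.log 5000 := Real.log_div (by norm_num) (by norm_num)
  have d4 : Real.log (303837 / 10000 : ℝ) = Real.log 303837 - Real.log 10000 := Real.log_div (by norm_num) (by norm_num)
  have d5 : Real.log (183837 / 10000 : ℝ) = Real.log 183837 - Real.log 10000 := Real.log_div (by norm_num) (by norm_num)
  have d6 : Real.log (20259 / 2000 : ℝ) = Real.log 20259 - Real.log 2000 := Real.log_div (by norm_num) (by norm_num)
  have d7 : Real.log (9741 / 2000 : ℝ) = Real.log 9741 - Real.log 2000 := Real.log_div (by norm_num) (by norm_num)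
  have d8 : Real.log (16259 / 2000 : ℝ) = Real.log 16259 - Real.log 2000 := Real.log_div (by norm_num) (by norm_num)
  have d9 : Real.log (7741 / 2000 : ℝ) = Real.log 7741 - Real.log 2000 := Real.log_div (by norm_num) (by norm_num)
  have d10 : Real.log (26271 / 5000 : ℝ) = Real.log 26271 - Real.log 5000 := Real.log_div (by norm_num) (by norm_num)
  have d11 : Real.log (13729 / 5000 : ℝ) = Real.log 13729 - Real.log 5000 := Real.log_div (by norm_num) (by norm_num)
  have d12 : Real.log (51271 / 5000 : ℝ) = Real.log 51271 - Real.log 5000 := Real.log_div (by norm_num) (by norm_num)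
  have d13 : Real.log (28729 / 5000 : ℝ) = Real.log 28729 - Real.log 5000 := Real.log_div (by norm_num) (by norm_num)
  rw [d0, d1, d2, d3, d4, d5, d6, d7, d8, d9, d10, d11, d12, d13]
  obtain ⟨lo0, hi0⟩ := log_8_bounds
  obtain ⟨lo1, hi1⟩ := log_12_bounds
  obtain ⟨lo2, hi2⟩ := log_15_bounds
  obtain ⟨lo3, hi3⟩ := log_16_bounds
  obtain ⟨lo4, hi4⟩ := log_2000_bounds
  obtain ⟨lo5, hi5⟩ := log_5000_bounds
  obtain ⟨lo6, hi6⟩ := log_7741_bounds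
  obtain ⟨lo7, hi7⟩ := log_9741_bounds
  obtain ⟨lo8, hi8⟩ := log_10000_bounds
  obtain ⟨lo9, hi9⟩ := log_13729_bounds
  obtain ⟨lo10, hi10⟩ := log_16259_bounds
  obtain ⟨lo11, hi11⟩ := log_18259_bounds
  obtain ⟨lo12, hi12⟩ := log_20259_bounds
  obtain ⟨lo13, hi13⟩ := log_26271_bounds
  obtain ⟨lo14, hi14⟩ := log_28729_bounds
  obtain ⟨lo15, hi15⟩ := log_48259_bounds
  obtain ⟨lo16, hi16⟩ := log_51271_bounds
  obtain ⟨lo17, hi17⟩ := log_56271_bounds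
  obtain ⟨lo18, hi18⟩ := log_116271_bounds
  obtain ⟨lo19, hi19⟩ := log_183837_bounds
  obtain ⟨lo20, hi20⟩ := log_303837_bounds
  linarith

/-- **Sharp lower rate**: `∀ ε > 0`, `e^{(85.08768883 − ε)n} ≤ |Q(a·n)|` for all large `n`. -/
theorem eventually_exp_le_abs_recordQ_sharp {ε : ℝ} (hε : 0 < ε) :
    ∀ᶠ n : ℕ in atTop, Real.exp ((8508768883 / 10 ^ 8 - ε) * n) ≤ |(recordQ n : ℝ)| := by
  filter_upwards [eventually_log_linear_le (a := 31) (b := 0) (by norm_num) le_rfl (show (0 : ℝ) < ε / 182 by positivity),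
    eventually_ge_atTop 1, tendsto_natCast_atTop_atTop.eventually_ge_atTop (196 / ε)] with n h31 hn1 hn2
  have hlow := abs_recordQ_ge_sharp hn1
  have hE := growthEntSharp_ge
  have hn : (0 : ℝ) ≤ n := Nat.cast_nonneg n
  rw [add_zero] at h31
  have h98 : (98 : ℝ) ≤ ε / 2 * n := by
    rw [div_le_iff₀ hε] at hn2; nlinarith
  rw [← Real.exp_log (abs_recordQ_pos n)]
  apply Real.exp_le_exp.mpr
  nlinarith

/-- **Both ends of the printed bracket**: ANY limit of `log|Q(a·n)|/n` lies in `[85.08768883, 85.08768884]`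
(the FACT `BrownZudilin2022.record_rates` asserts a limit in the open bracket; its existence is not proved here). -/
theorem rate_mem_of_tendsto_sharp {c : ℝ} (h : Tendsto (fun n : ℕ => Real.log |(recordQ n : ℝ)| / n) atTop (𝓝 c)) :
    (8508768883 / 10 ^ 8 : ℝ) ≤ c ∧ c ≤ 8508768884 / 10 ^ 8 := by
  refine ⟨?_, (rate_mem_of_tendsto h).2⟩
  refine le_of_forall_pos_le_add fun ε hε => ?_
  have hev : ∀ᶠ n : ℕ in atTop, (8508768883 / 10 ^ 8 : ℝ) - ε ≤ Real.log |(recordQ n : ℝ)| / n := by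
    filter_upwards [eventually_exp_le_abs_recordQ_sharp hε, eventually_ge_atTop 1] with n hn hn1
    have hnpos : (0 : ℝ) < n := by exact_mod_cast hn1
    rw [le_div_iff₀ hnpos]
    have := Real.log_le_log (Real.exp_pos _) hn
    rwa [Real.log_exp] at this
  have := ge_of_tendsto h hev
  linarith

/-- The Q-half of `record_rates`, both ends: the limit it asserts lies in the CLOSED printed bracket. -/
theorem record_rates_Q_bracket (h : Literature.NumberTheory.Irrationality.BrownZudilin2022.record_rates) :
    ∃ c : ℝ, Tendsto (fun n : ℕ => Real.log |(recordQ n : ℝ)| / n) atTop (𝓝 c)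
      ∧ (8508768883 / 10 ^ 8 : ℝ) ≤ c ∧ c ≤ 8508768884 / 10 ^ 8 := by
  obtain ⟨-, c, -, hc⟩ := h
  exact ⟨c, hc, rate_mem_of_tendsto_sharp hc⟩

end Summit.KontsevichZagierPeriods.Zeta5Search.RecordRay
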